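import Literature.NumberTheory.GaloisCohomology.Howard2004.TransportUnramified
import Literature.NumberTheory.GaloisRepresentations.PPrimaryDevissage
import Literature.NumberTheory.GaloisRepresentations.ContinuousCohomologyConnecting
import HarnessLib

/-!
# Howard 2004, H.4: isotropy of strict local conditions under the local cup-product pairing of a
# `DualityDatum` (the «`⊆`» half of self-orthogonality), from orthogonality of the defining submodules

`Proofs` file (theorems only; no definition, no named fact, no instance, no `sorry`) in the currency of
the cell's typing of B. Howard, *The Heegner point Kolyvagin system*, Compositio Math. 140 (2004), §1.3
(`Literature/NumberTheory/GaloisCohomology/Howard2004/SelmerTriples.lean`: `ConjugationDatum`,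
`ConjugationDatum.transportH1 : H¹(K_v̄, T) → H¹(K_v, Tw T)`, `DualityDatum`, `DualityDatum.localCup`,
`DualityDatum.IsSelfOrthogonalAt`).

Howard, H.4 (arXiv:1202.6340 p. 7, L69–82): «there is a perfect, symmetric, `R`-bilinear pairing
`T × T → R(1)` … we ask that the local condition `F` be its own exact orthogonal complement under the
induced local pairing `H¹(K_v, T) × H¹(K_v̄, T) → R`»; for the ordinary condition at `v ∣ p` this rests on
Lemma 3.1.1 / Def. 3.2.6 remark («`Fil_v T_𝔮` is its own exact orthogonal complement under `e_𝔮`», «the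
local conditions … are everywhere exact orthogonal complements under the local Tate pairing», arXiv p. 15
L60–62, p. 16 L108–110).  The ISOTROPY half of such a statement is formal and is proved here once and for
all: if `V ≤ T` and `V' ≤ T` are subgroups with **`e(V, δ_v · V') = 0`** (`δ_v` the inner correction of
the conjugation datum at `v`), then every class of `H¹(K_v, T)` represented by a `V`-valued cocycle is
`localCup`-orthogonal to the transport (`transportH1`) of every class of `H¹(K_v̄, T)` represented by a
`V'`-valued cocycle (§2: the cup-product `2`-cocycle `(g, h) ↦ e(a(g), g · δ_v b(φ_v h))
= e(a(g), δ_v (b(φ_v(gh)) - b(φ_v g)))` vanishes identically); hence (§3, via the long exact sequence of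
`0 → V → T → T/V → 0`, tree `isSES_subtype_mkQ` + `IsSES.exists_map_one_eq_of_map_one_eq_zero`) the tree's
STRICT conditions `DiscreteGaloisModule.strictSubgroup _ V _ = ker (H¹(K_v, T) → H¹(K_v, T/V))` at `v` and
`V'` at `v̄` are mutually `localCup`-orthogonal — exactly the two «`→`» implications of
`DualityDatum.IsSelfOrthogonalAt` for a pair of strict conditions (`localCup_eq_zero_of_mem_strictSubgroup`).
Consumers: the strict ORDINARY cores `OrdinaryFiltration.ordinaryCore` of D1's `F_𝔮`
(`ZpExtensionEisensteinSelmerStructure`, cell `pub/bsd-print-x9`, memo `H4-AT-P-PLAN` steps (E2)/(A1)), and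
any Greenberg-strict condition.

§1 records the cocycle formula of `localCup` (`[f] ∪ [g] = [(σ, τ) ↦ e(f σ, σ · g τ)]`, tree
`ContPairing.cupProduct_oneCocycleClass_eq_twoCocycleClass`); that of `transportH1` (`[c] ↦ [h ↦ δ_v · c(φ_v h)]`)
is `ConjugationDatum.transportH1_oneCocycleClass` (`TransportUnramified.lean`, x9-p1-w4).
Nothing here is specific to elliptic curves; BSD is not proved by any of this.

References: [Howard2004HeegnerKolyvagin] B. Howard, Compositio Math. 140 (2004) 1439–1472, §1.3 H.4,
Lemma 3.1.1, Def. 3.2.6 (arXiv:1202.6340 p. 7 L69–82, p. 15 L60–62, p. 16 L108–110);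
[NeukirchSchmidtWingberg2008] (1.4.4)–(1.4.8) (cup product on inhomogeneous cochains);
[SerreGaloisCohomology1997] I §2.2 (long exact sequence), I §2.4 (compatible pairs).
-/

set_option autoImplicit false

noncomputable section

open Function NumberField IsDedekindDomain Field
open scoped NumberField ContRepresentation

namespace Literature.NumberTheory.GaloisCohomology.Howard2004

open Literature.NumberTheory.GaloisRepresentations
open Literature.NumberTheory.GaloisRepresentations.DiscreteGaloisModule

variable {K : Type} [Field K] [NumberField K] {M : Type} [AddCommGroup M] [TopologicalSpace M]
  [DiscreteTopology M] {R : Type} [CommRing R] [Module R M] [TopologicalSpace R] [DiscreteTopology R]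
  {p : ℕ} [Fact p.Prime] [Algebra ℤ_[p] R] {cd : ConjugationDatum K} {ρ : DiscreteGaloisModule K M}

/-! ## §1 The cocycle formula of `localCup` (that of `transportH1`, `[c] ↦ [h ↦ δ_v · c(φ_v h)]`, is
`ConjugationDatum.transportH1_oneCocycleClass` of `TransportUnramified.lean`) -/

namespace DualityDatum

/-- **`[f] ∪ [g] = [(σ, τ) ↦ e(f σ, σ ·_{Tw} g τ)]`**: Howard's induced local pairing `localCup` on classes of
crossed homomorphisms is the class of the inhomogeneous cup-product `2`-cocycle of the module pairing
`e : T × Tw T → R(1)` (tree `ContPairing.cupCocycle`).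
[cite: Howard2004HeegnerKolyvagin, H.4 (arXiv p. 7, L78–82: the induced local pairing)]
[cite: NeukirchSchmidtWingberg2008, (1.4.8) (cup product of 1-cocycles)] -/
theorem localCup_oneCocycleClass (D : DualityDatum p cd ρ R) (v : Place K)
    (f : contOneCocycles (DiscreteGaloisModule.toTopRep (ρ.toLocal v)))
    (g : contOneCocycles (DiscreteGaloisModule.toTopRep ((cd.twist ρ).toLocal v))) :
    D.localCup v (oneCocycleClass _ f) (oneCocycleClass _ g) =
      haveI : CompactSpace (absoluteGaloisGroup (Place.Completion v)) := absoluteGaloisGroup_compactSpace _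
      twoCocycleClass _ ((D.ePairingLocal v).cupCocycle f g) := by
  haveI : CompactSpace (absoluteGaloisGroup (Place.Completion v)) := absoluteGaloisGroup_compactSpace _
  change (D.ePairingLocal v).cupProduct (oneCocycleClass _ f) (oneCocycleClass _ g) = _
  rw [ContPairing.cupProduct_oneCocycleClass_eq_twoCocycleClass]

/-- The cup-product `2`-cocycle of `localCup`, evaluated: `(f ∪ g)(σ, τ) = e(f σ, g(στ) - g σ)`.
[cite: NeukirchSchmidtWingberg2008, (1.4.8)] [cite: Howard2004HeegnerKolyvagin, H.4 (arXiv p. 7, L78–82)] -/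
theorem ePairingLocal_cupCocycle_apply (D : DualityDatum p cd ρ R) (v : Place K)
    (f : contOneCocycles (DiscreteGaloisModule.toTopRep (ρ.toLocal v)))
    (g : contOneCocycles (DiscreteGaloisModule.toTopRep ((cd.twist ρ).toLocal v)))
    (σ τ : absoluteGaloisGroup (Place.Completion v)) :
    ((D.ePairingLocal v).cupCocycle f g).1 (σ, τ) = D.e (f.1 σ) (g.1 (σ * τ) - g.1 σ) :=
  rfl

/-! ## §2 Isotropy on cocycles with values in `e`-orthogonal subgroups -/

/-- **Cocycle-level isotropy.** Let `V, V' ≤ T` be subgroups with `e(s, δ_v t) = 0` for all `s ∈ V`,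
`t ∈ V'` (`δ_v` the inner correction of the conjugation datum at the finite place `v`). For a `V`-valued
crossed homomorphism `f : Γ_{K_v} → T` and a `V'`-valued crossed homomorphism `g : Γ_{K_v̄} → T`, the local
pairing of `[f]` with the transport of `[g]` vanishes: the cup-product cocycle is
`(σ, τ) ↦ e(f σ, δ_v (g(φ_v(στ)) - g(φ_v σ)))`, identically `0`.
[cite: Howard2004HeegnerKolyvagin, H.4 and Lemma 3.1.1 (arXiv p. 7 L78–82, p. 15 L60–62: Fil_v is isotropic under e_𝔮)]
[cite: NeukirchSchmidtWingberg2008, (1.4.8)] -/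
theorem localCup_oneCocycleClass_transportH1_eq_zero (D : DualityDatum p cd ρ R)
    (v : HeightOneSpectrum (𝓞 K)) (V V' : AddSubgroup M)
    (horth : ∀ s ∈ V, ∀ t ∈ V', D.e s (ρ (cd.δ v) t) = 0)
    (f : contOneCocycles (DiscreteGaloisModule.toTopRep (ρ.toLocal (Sum.inr v))))
    (hf : ∀ σ, f.1 σ ∈ V)
    (g : contOneCocycles (DiscreteGaloisModule.toTopRep (ρ.toLocal (Sum.inr (cd.σ • v)))))
    (hg : ∀ τ, g.1 τ ∈ V') :
    D.localCup (Sum.inr v) (oneCocycleClass _ f) (cd.transportH1 ρ v (oneCocycleClass _ g)) = 0 := by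
  haveI : CompactSpace (absoluteGaloisGroup (Place.Completion (Sum.inr v : Place K))) :=
    absoluteGaloisGroup_compactSpace _
  rw [ConjugationDatum.transportH1_oneCocycleClass]
  refine (D.localCup_oneCocycleClass (Sum.inr v) f _).trans ?_
  have hc : (D.ePairingLocal (Sum.inr v)).cupCocycle f
      (contOneCocycles.pullback (cd.φ v) (cd.transportHom ρ v) g) = 0 := by
    refine Subtype.ext (ContinuousMap.ext fun στ ↦ ?_)
    obtain ⟨σ, τ⟩ := στ
    change D.e (f.1 σ) (ρ (cd.δ v) (g.1 (cd.φ v (σ * τ))) - ρ (cd.δ v) (g.1 (cd.φ v σ))) = 0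
    rw [← map_sub]
    exact horth _ (hf σ) _ (V'.sub_mem (hg _) (hg _))
  exact (congrArg (twoCocycleClass _) hc).trans (twoCocycleClass_zero _)

/-! ## §3 Isotropy of the strict conditions `ker (H¹(K_v, T) → H¹(K_v, T/V))` -/

section Strict

variable {F : Type} [Field F] {N : Type} [AddCommGroup N] [TopologicalSpace N] [DiscreteTopology N]

/-- **A class in the strict condition `ker (H¹(F, T) → H¹(F, T/V))` is represented by a `V`-valued crossed
homomorphism** (exactness of `H¹(F, V) → H¹(F, T) → H¹(F, T/V)` in the middle: tree `isSES_subtype_mkQ` and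
`IsSES.exists_map_one_eq_of_map_one_eq_zero`). [cite: SerreGaloisCohomology1997, I §2.2 (long exact sequence)]
[cite: Howard2004HeegnerKolyvagin, §3.1 (arXiv p. 15, L62–66: H¹_ord = im H¹(K_v, Fil_v))] -/
theorem exists_oneCocycleClass_eq_of_mem_strictSubgroup (τ : DiscreteGaloisModule F N) (V : Submodule ℤ N)
    (hV : ∀ σ : absoluteGaloisGroup F, V ≤ V.comap (τ σ)) {x : galoisCohomology τ 1}
    (hx : x ∈ DiscreteGaloisModule.strictSubgroup τ V hV) :
    ∃ f : contOneCocycles (DiscreteGaloisModule.toTopRep τ), (∀ σ, f.1 σ ∈ V) ∧ oneCocycleClass _ f = x := by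
  haveI : CompactSpace (absoluteGaloisGroup F) := absoluteGaloisGroup_compactSpace _
  have hx' : cohomologyMap (ContinuousRep.mkQHom τ V hV) 1 x = 0 := hx
  obtain ⟨a, ha⟩ := (isSES_subtype_mkQ τ V hV).exists_map_one_eq_of_map_one_eq_zero x hx'
  obtain ⟨f₀, rfl⟩ := oneCocycleClass_surjective _ a
  refine ⟨contOneCocycles.pullback (ContinuousMonoidHom.id _) (resIdHom (subtypeHom τ V hV)) f₀,
    fun σ ↦ (f₀.1 σ).2, ?_⟩
  rw [← ha, cohomologyMap_oneCocycleClass]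

end Strict

/-- **Isotropy of strict conditions (the «`→`» half of `IsSelfOrthogonalAt`).** Let `V ≤ T` be a
`Γ_{K_v}`-stable and `V' ≤ T` a `Γ_{K_v̄}`-stable subgroup (`v̄ = v^σ`) with `e(V, δ_v V') = 0`. Then the strict
condition `ker (H¹(K_v, T) → H¹(K_v, T/V))` at `v` is `localCup`-orthogonal to the transport
`transportH1 (ker (H¹(K_v̄, T) → H¹(K_v̄, T/V')))` of the strict condition at `v̄` — for Howard's `T_𝔮` with
`V = Fil_v T_𝔮`, `V' = Fil_v̄ T_𝔮` this is «`Fil_v` is isotropic» (Lemma 3.1.1) read on `H¹`.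
[cite: Howard2004HeegnerKolyvagin, H.4, Lemma 3.1.1 and Def. 3.2.6 (arXiv p. 7 L78–82, p. 15 L60–62, p. 16 L108–110)]
[cite: SerreGaloisCohomology1997, I §2.2] -/
theorem localCup_eq_zero_of_mem_strictSubgroup (D : DualityDatum p cd ρ R) (v : HeightOneSpectrum (𝓞 K))
    (V V' : Submodule ℤ M)
    (hV : ∀ σ : absoluteGaloisGroup (v.adicCompletion K), V ≤ V.comap (GaloisRep.toLocal v ρ σ))
    (hV' : ∀ σ : absoluteGaloisGroup ((cd.σ • v).adicCompletion K),
      V' ≤ V'.comap (GaloisRep.toLocal (cd.σ • v) ρ σ))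
    (horth : ∀ s ∈ V, ∀ t ∈ V', D.e s (ρ (cd.δ v) t) = 0)
    {x : galoisCohomology (ρ.toLocal (Sum.inr v)) 1}
    (hx : x ∈ DiscreteGaloisModule.strictSubgroup (GaloisRep.toLocal v ρ) V hV)
    {y : galoisCohomology ((cd.twist ρ).toLocal (Sum.inr v)) 1}
    (hy : y ∈ (DiscreteGaloisModule.strictSubgroup (GaloisRep.toLocal (cd.σ • v) ρ) V' hV').map
      (cd.transportH1 ρ v)) :
    D.localCup (Sum.inr v) x y = 0 := by
  obtain ⟨f, hf, rfl⟩ := exists_oneCocycleClass_eq_of_mem_strictSubgroup _ V hV hx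
  obtain ⟨y₀, hy₀, rfl⟩ := AddSubgroup.mem_map.mp hy
  obtain ⟨g, hg, rfl⟩ := exists_oneCocycleClass_eq_of_mem_strictSubgroup _ V' hV' hy₀
  exact D.localCup_oneCocycleClass_transportH1_eq_zero v V.toAddSubgroup V'.toAddSubgroup horth f hf g hg

/-- The same, in the shape of the two «`→`» clauses of `DualityDatum.IsSelfOrthogonalAt` for the pair of
strict conditions (`Fbar := (strict at v̄).map transportH1`): (i) `x ∈ F_v → ∀ y ∈ Fbar, ⟨x, y⟩_v = 0` and
(ii) `y ∈ Fbar → ∀ x ∈ F_v, ⟨x, y⟩_v = 0`. [cite: Howard2004HeegnerKolyvagin, H.4 (arXiv p. 7, L78–82)] -/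
theorem isotropic_strictSubgroup (D : DualityDatum p cd ρ R) (v : HeightOneSpectrum (𝓞 K))
    (V V' : Submodule ℤ M)
    (hV : ∀ σ : absoluteGaloisGroup (v.adicCompletion K), V ≤ V.comap (GaloisRep.toLocal v ρ σ))
    (hV' : ∀ σ : absoluteGaloisGroup ((cd.σ • v).adicCompletion K),
      V' ≤ V'.comap (GaloisRep.toLocal (cd.σ • v) ρ σ))
    (horth : ∀ s ∈ V, ∀ t ∈ V', D.e s (ρ (cd.δ v) t) = 0) :
    (∀ x ∈ DiscreteGaloisModule.strictSubgroup (GaloisRep.toLocal v ρ) V hV,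
      ∀ y ∈ (DiscreteGaloisModule.strictSubgroup (GaloisRep.toLocal (cd.σ • v) ρ) V' hV').map
        (cd.transportH1 ρ v), D.localCup (Sum.inr v) x y = 0) ∧
    (∀ y ∈ (DiscreteGaloisModule.strictSubgroup (GaloisRep.toLocal (cd.σ • v) ρ) V' hV').map
        (cd.transportH1 ρ v),
      ∀ x ∈ DiscreteGaloisModule.strictSubgroup (GaloisRep.toLocal v ρ) V hV, D.localCup (Sum.inr v) x y = 0) :=
  ⟨fun _ hx _ hy ↦ D.localCup_eq_zero_of_mem_strictSubgroup v V V' hV hV' horth hx hy,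
    fun _ hy _ hx ↦ D.localCup_eq_zero_of_mem_strictSubgroup v V V' hV hV' horth hx hy⟩

end DualityDatum

end Literature.NumberTheory.GaloisCohomology.Howard2004

end
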